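import Summits.CriticalPhenomena.CardyFormulaZ2.Theorems.CardyBoundaryCoulombGasBoundaryDefectGaussianRStubTransportPathsPart19

/-!
# Stub `stub_transportPaths` of line `rainbow-monomials-in-excursion-kernels` — Part 25:
# separation of a mover from the parked points (continuum distances)
# (crux `CardyBoundaryCoulombGas.BoundaryDefectGaussianR`, stmt-CriticalPhenomena-14132)

Lower bounds for the distance between the foot `q = γ t` of a mover's position and the feet of
the parked points of TRANSPORT:

* `tp_sep_regimes` — versus a parked INITIAL point `γ (mark i')`: the mover's parameter range
  `[e₁, e₂]` (from its own mark to the anchor) contains no translate of `mark i'`, and all cyclic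
  gaps are `≥ 2 η₀`; so either the tube bound `κ₁` applies (cyclic distance `≥ η₀`), or the mover
  is in one of the two end regimes (within `θ₁` of `γ e₁`, within `θ₂` of `γ e₂`) where the
  clearances `d₁, d₂` of the end points from `γ (mark i')` apply;
* `tp_slot_dist` — versus a point `w` of the anchor edge `zA` seen from another edge
  `z ∈ [zA + 1, zA + M - 1]`: at least `min κ₀ (distance of w to the corners of its edge)`
  (adjacent edges: Pythagoras at the shared corner, Part 11; other edges: `κ₀`).
All [folklore].
-/

noncomputable section

open Set Filter Metric Topology
open Literature.Probability.RandomPlanarGeometry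
open Summit.CriticalPhenomena.CardyFormulaZ2.Cruxes.RectilinearCardy.ExcursionKernelCovariance

namespace Summit.CriticalPhenomena.CardyFormulaZ2.Cruxes.BoundaryDefectGaussianR.RainbowMonomialsInExcursionKernels

/-- **Separation regimes.** See the module docstring. [folklore] -/
theorem tp_sep_regimes (γ : ℝ → ℂ) {η₀ κ₁ : ℝ} (hη₀ : 0 < η₀)
    (htube : ∀ s t : ℝ, (∀ n : ℤ, η₀ ≤ |s - t - n|) → κ₁ ≤ dist (γ s) (γ t))
    {e₁ e₂ μ : ℝ} (hgap₁ : ∀ n : ℤ, 2 * η₀ ≤ |e₁ - μ - n|) (hgap₂ : ∀ n : ℤ, 2 * η₀ ≤ |e₂ - μ - n|)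
    (hout : ∀ n : ℤ, μ + n ∉ Ioo e₁ e₂)
    {d₁ d₂ θ₁ θ₂ : ℝ} (hd₁ : d₁ ≤ dist (γ e₁) (γ μ)) (hd₂ : d₂ ≤ dist (γ e₂) (γ μ))
    {t : ℝ} {q : ℂ} (hq : q = γ t)
    (hregime : t ∈ Icc e₁ e₂ ∨ dist q (γ e₁) ≤ θ₁ ∨ dist q (γ e₂) ≤ θ₂) :
    min κ₁ (min (d₁ - θ₁) (d₂ - θ₂)) ≤ dist q (γ μ) := by
  rcases hregime with ht | h1 | h2
  · -- inside the range: the tube bound applies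
    refine (min_le_left _ _).trans ?_
    rw [hq]
    refine htube t μ fun n => ?_
    by_contra hlt
    push Not at hlt
    have habs := abs_lt.1 hlt
    have hnot := hout n
    rw [mem_Ioo, not_and_or, not_lt, not_lt] at hnot
    rcases hnot with hle | hge
    · -- `μ + n ≤ e₁ ≤ t`
      have hg := hgap₁ n
      have : e₁ - μ - n < 2 * η₀ := by linarith [ht.1]
      have h0 : 0 ≤ e₁ - μ - n := by linarith
      rw [abs_of_nonneg h0] at hg
      linarith
    · have hg := hgap₂ n
      have : -(2 * η₀) < e₂ - μ - n := by linarith [ht.2]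
      have h0 : e₂ - μ - n ≤ 0 := by linarith
      rw [abs_of_nonpos h0] at hg
      linarith
  · refine (min_le_right _ _).trans ((min_le_left _ _).trans ?_)
    have := dist_triangle (γ e₁) q (γ μ)
    rw [dist_comm] at h1
    linarith
  · refine (min_le_right _ _).trans ((min_le_right _ _).trans ?_)
    have := dist_triangle (γ e₂) q (γ μ)
    rw [dist_comm] at h2
    linarith

/-- **Distance from the anchor edge to the other edges.** See the module docstring.
[folklore] -/
theorem tp_slot_dist (D : JordanDomain) {M : ℕ} {c : ℤ → ℝ} {a τ : ℤ → ℕ}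
    (hcmono : StrictMono c) (hcper : ∀ z, c (z + M) = c z + 1)
    (ha4 : ∀ z, a z < 4) (hτ : ∀ z, τ z = 1 ∨ τ z = 3)
    (hmodτ : ∀ z, (a z + τ z) % 4 = (a (z - 1) + 2) % 4)
    (hdir : ∀ z, ∀ t ∈ Icc (c z) (c (z + 1)), D.boundary t =
      D.boundary (c z) + ((‖D.boundary t - D.boundary (c z)‖ : ℝ) : ℂ) * Complex.I ^ (a z))
    (hmono : ∀ z, StrictMonoOn (fun t => ‖D.boundary t - D.boundary (c z)‖) (Icc (c z) (c (z + 1))))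
    (hash : ∀ (z n : ℤ), a (z + n * M) = a z)
    {κ₀ : ℝ} (hκ₀ : ∀ z z' : ℤ, z + 2 ≤ z' → z' ≤ z + M - 2 →
      ∀ t ∈ Icc (c z) (c (z + 1)), ∀ t' ∈ Icc (c z') (c (z' + 1)),
        κ₀ ≤ dist (D.boundary t) (D.boundary t'))
    (zA z : ℤ) (hz1 : zA + 1 ≤ z) (hz2 : z ≤ zA + M - 1)
    {tw : ℝ} (htw : tw ∈ Icc (c zA) (c (zA + 1))) {t : ℝ} (ht : t ∈ Icc (c z) (c (z + 1))) :
    min κ₀ (min ‖D.boundary tw - D.boundary (c zA)‖ ‖D.boundary (c (zA + 1)) - D.boundary tw‖) ≤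
      dist (D.boundary t) (D.boundary tw) := by
  set γ := D.boundary with hγ
  have hcz : ∀ z : ℤ, c z ≤ c (z + 1) := fun z => (hcmono (by omega : z < z + 1)).le
  by_cases hfar : zA + 2 ≤ z ∧ z ≤ zA + M - 2
  · refine (min_le_left _ _).trans ?_
    rw [dist_comm]
    exact hκ₀ zA z hfar.1 hfar.2 tw htw t ht
  rw [not_and_or, not_le, not_le] at hfar
  refine (min_le_right _ _).trans ?_
  rcases hfar with hnext | hprev
  · -- `z = zA + 1`: Pythagoras at the corner `γ (c (zA + 1))`
    have hz : z = zA + 1 := by omega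
    subst hz
    refine (min_le_right _ _).trans ?_
    set P := γ (c (zA + 1)) with hP
    set ℓ := ‖P - γ (c zA)‖ with hℓ
    set sw := ‖γ tw - γ (c zA)‖ with hsw
    have hw : γ tw = P + (((sw - ℓ : ℝ)) : ℂ) * Complex.I ^ (a zA) := by
      rw [hdir zA tw htw, hP, hdir zA (c (zA + 1)) ⟨hcz zA, le_rfl⟩]
      push_cast; ring
    have hq : γ t = P + ((‖γ t - P‖ : ℝ) : ℂ) * Complex.I ^ (a (zA + 1)) := hdir (zA + 1) t ht
    have hodd : (a zA + a (zA + 1)) % 2 = 1 := by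
      have := tp_consecutive_odd hτ hmodτ (zA + 1)
      rw [show zA + 1 - 1 = zA by ring] at this
      omega
    have key := tp_adjacent_dist (ha4 zA) (ha4 (zA + 1)) hodd P (sw - ℓ) ‖γ t - P‖
    rw [← hw, ← hq] at key
    have hlen : ‖γ (c (zA + 1)) - γ tw‖ = ℓ - sw := by
      have h2 := hmono zA htw ⟨hcz zA, le_rfl⟩
      rcases htw.2.eq_or_lt with h | h
      · rw [h, sub_self, norm_zero, hsw, h, hℓ, hP, sub_self]
      · have e : γ (c (zA + 1)) - γ tw = (((ℓ - sw : ℝ)) : ℂ) * Complex.I ^ (a zA) := by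
          rw [hw]; push_cast; ring
        have hlt := h2 h
        simp only at hlt
        rw [e, norm_mul, norm_pow, Complex.norm_I, one_pow, mul_one, Complex.norm_real,
          Real.norm_eq_abs, abs_of_nonneg (by rw [hℓ, hsw, hP]; linarith)]
    rw [hlen, show ℓ - sw = |sw - ℓ| by rw [abs_sub_comm, abs_of_nonneg (by
      rw [hℓ, hsw, hP]
      have h2 := (hmono zA).monotoneOn htw ⟨hcz zA, le_rfl⟩ htw.2
      simpa using h2)]]
    exact key
  · -- `z = zA + M - 1`: Pythagoras at the corner `γ (c zA) = γ (c (zA + M))`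
    have hz : z = zA + M - 1 := by omega
    subst hz
    refine (min_le_left _ _).trans ?_
    have hq0 := hdir (zA + M - 1) t ht
    have hend := hdir (zA + M - 1) (c (zA + M - 1 + 1)) ⟨hcz _, le_rfl⟩
    have hPM : γ (c (zA + M - 1 + 1)) = γ (c zA) := by
      rw [show zA + ↑M - 1 + 1 = zA + 1 * ↑M by ring]
      exact tp_point_shift D hcper zA 1
    have haM : a (zA + M - 1) = a (zA - 1) := by
      rw [show zA + ↑M - 1 = (zA - 1) + 1 * ↑M by ring, hash]
    rw [hPM] at hend
    rw [haM] at hq0 hend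
    set P := γ (c zA) with hP
    set st := ‖γ t - γ (c (zA + M - 1))‖ with hst
    set ℓ' := ‖P - γ (c (zA + M - 1))‖ with hℓ'
    set sw := ‖γ tw - P‖ with hsw
    have hw : γ tw = P + ((sw : ℝ) : ℂ) * Complex.I ^ (a zA) := hdir zA tw htw
    have hq : γ t = P + (((st - ℓ' : ℝ)) : ℂ) * Complex.I ^ (a (zA - 1)) := by
      push_cast
      linear_combination hq0 - hend
    have hodd : (a zA + a (zA - 1)) % 2 = 1 := tp_consecutive_odd hτ hmodτ zA
    have key := tp_adjacent_dist (ha4 zA) (ha4 (zA - 1)) hodd P sw (st - ℓ')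
    rw [← hw, ← hq] at key
    rwa [abs_of_nonneg (norm_nonneg _)] at key

/-- **Registered sub-goal `s7_sepRegimes` of stub `stub_transportPaths`** (separation regimes of a
mover versus a parked initial point, one-line form of `tp_sep_regimes`). [folklore] -/
theorem s7_sepRegimes : ∀ (γ : ℝ → ℂ) (η₀ κ₁ : ℝ), (0 < η₀) → (∀ s t : ℝ, (∀ n : ℤ, η₀ ≤ |s - t - n|) → κ₁ ≤ dist (γ s) (γ t)) → ∀ (e₁ e₂ μ : ℝ), (∀ n : ℤ, 2 * η₀ ≤ |e₁ - μ - n|) → (∀ n : ℤ, 2 * η₀ ≤ |e₂ - μ - n|) → (∀ n : ℤ, μ + n ∉ Set.Ioo e₁ e₂) → ∀ (d₁ d₂ θ₁ θ₂ : ℝ), (d₁ ≤ dist (γ e₁) (γ μ)) → (d₂ ≤ dist (γ e₂) (γ μ)) → ∀ (t : ℝ) (q : ℂ), (q = γ t) → (t ∈ Set.Icc e₁ e₂ ∨ dist q (γ e₁) ≤ θ₁ ∨ dist q (γ e₂) ≤ θ₂) → min κ₁ (min (d₁ - θ₁) (d₂ - θ₂)) ≤ dist q (γ μ) :=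
  fun γ _ _ hη₀ htube _ _ _ hgap₁ hgap₂ hout _ _ _ _ hd₁ hd₂ _ _ hq hregime =>
    tp_sep_regimes γ hη₀ htube hgap₁ hgap₂ hout hd₁ hd₂ hq hregime

end Summit.CriticalPhenomena.CardyFormulaZ2.Cruxes.BoundaryDefectGaussianR.RainbowMonomialsInExcursionKernels

end
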